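import Mathlib
import Summits.ValiantsHypothesis.ValiantsHypothesis.Theorems.FifoMatchingNNDivisionHardArcFaces
import Summits.ValiantsHypothesis.ValiantsHypothesis.Theses.FifoMatching
import HarnessLib

/-!
# Route FifoMatching — crux `NNDivisionHard` (stmt-ValiantsHypothesis-21181): the ARC-GENERIC tier —
# a cofactor whose minimal-`x_e`-usage face is a single monomial, for SOME avoidable arc `e`, is not a certificate;
# BY NAME, 21181 ⟺ its ARC-NON-GENERIC tier

`…ArcElimination.lean`: `top_{𝟙_{≠e}} h = c · x^d` ⇒ `L₊(NN_n^{¬{e}}) ≤ 16 ((2n+1) (L₊(NN_n · h) + 2))²`.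
`…ArcFaces.lean`: every single-arc-avoiding face `NN_n^{¬{e}}` is hard (`arcFace_qp_hard`).  Together:

* ★★ `arcGeneric_not_certificate_qp` — **for every `c`, eventually in `n`: for every arc variable `e` avoided by some
  nest-free perfect matching and every cofactor `h` whose outer face `top_{𝟙_{≠e}} h` (the terms of `h` with the most
  degree OFF `e`; for homogeneous `h`, the terms of least `x_e`-degree) is a single monomial,
  `2^((log₂ n + c)^c) < L₊(NN_n · h) + L₊(h)`;**
* ★ BY NAME `nnDivisionHard_iff_arcNonGenericTier` — `Theses.FifoMatching.NNDivisionHard` ⟺ the same inequality for the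
  ARC-NON-GENERIC cofactors: those `h ≠ 0` such that for EVERY arc `e` avoided by some nest-free perfect matching the face
  `top_{𝟙_{≠e}} h` has at least two terms (is not of the form `c · x^d`, `c ≠ 0`).

READING.  This genericity asks nothing of prefix blocks or adjacent arcs: one arc `e`, anywhere, whose least usage among the
top-`𝟙_{≠e}` terms of `h` is achieved by ONE monomial, is fatal — whatever the degree of `h`.  Power sums `(Σ_M c_M x^M)^D`
led by a nest-free matching that some single arc separates from the others, binomial powers, monomials times such, … are
decided; symmetric sums such as `NN_n^D`, `NC_n^D` (decided elsewhere) and, in general, cofactors all of whose single-arc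
faces have ≥ 2 terms remain the residual of this tier.

HONEST FRAMING: a genericity tier for ONE candidate family; stmt-21181 stays OPEN; nothing here bears on `NNNotVP` or on
VP ≠ VNP (NOT proved).  No definitions, no named facts.
References: Hrubeš–Yehudayoff 2021 §6 Problem 2 [HrubesYehudayoff2021]; Jukna–Seiwert–Sergeev 2022 Thm 1
[JuknaSeiwertSergeev2022].
-/

noncomputable section

-- Sub = Summit single-conjunct layout: the duplicated namespace component is mandated by the tree.
set_option linter.dupNamespace false
set_option autoImplicit false

namespace Summit.ValiantsHypothesis.ValiantsHypothesis.Theorems.FifoMatching.NNDivisionHard.ArcGenericTier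

open Finset MvPolynomial Literature.Computability.AlgebraicComplexity
open Summit.ValiantsHypothesis.ValiantsHypothesis.Theorems.ZeroOneTransfer.Negative (topComponent)
open Summit.ValiantsHypothesis.ValiantsHypothesis.Theorems.FifoMatching.NNDivisionHard.ArcElimination
  (complexity_avoidingFace_le_of_top_monomial)
open Summit.ValiantsHypothesis.ValiantsHypothesis.Theorems.FifoMatching.NNDivisionHard.ArcFaces (arcFace_qp_hard)
open scoped NNReal BigOperators

variable {n : ℕ}

/-- ★★ **ARC-GENERIC COFACTORS ARE NOT CERTIFICATES.**  For every `c`, eventually in `n`: if `e` is an arc variable avoided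
by some nest-free perfect matching and the outer face `top_{𝟙_{≠e}} h` of the cofactor `h` is a single monomial `a · x^d`
(`a ≠ 0`), then `2^((log₂ n + c)^c) < L₊(NN_n · h) + L₊(h)`. [cite: HrubesYehudayoff2021, §6 Problem 2]
[cite: JuknaSeiwertSergeev2022, Thm 1] -/
theorem arcGeneric_not_certificate_qp (c : ℕ) : ∃ n₀ : ℕ, ∀ n : ℕ, n₀ ≤ n → ∀ e : Fin (2 * n) × Fin (2 * n),
    (∃ M ∈ nestFreeMatchings (2 * n), ∀ j ∈ openers M, (j, M j) ∉ ({e} : Finset (Fin (2 * n) × Fin (2 * n)))) →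
    ∀ (h : MvPolynomial (Fin (2 * n) × Fin (2 * n)) ℝ≥0) (d : (Fin (2 * n) × Fin (2 * n)) →₀ ℕ) (a : ℝ≥0), a ≠ 0 →
      topComponent (fun v : Fin (2 * n) × Fin (2 * n) =>
        if v ∈ ({e} : Finset (Fin (2 * n) × Fin (2 * n))) then 0 else 1) h = monomial d a →
      2 ^ ((Nat.log 2 n + c) ^ c) < complexity (nestFreeMatchingPoly n ℝ≥0 * h) + complexity h := by
  obtain ⟨n₀, hn₀⟩ := arcFace_qp_hard c
  refine ⟨n₀, fun n hn e he h d a ha htop => ?_⟩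
  have hface := complexity_avoidingFace_le_of_top_monomial {e} he ha htop
  exact lt_of_lt_of_le (hn₀ n hn e _ hface) (Nat.le_add_right _ _)

/-- ★ **BY NAME: `NNDivisionHard` ⟺ its ARC-NON-GENERIC tier.**  The crux (stmt-ValiantsHypothesis-21181) is equivalent to the
same inequality for the cofactors `h ≠ 0` all of whose single-arc outer faces `top_{𝟙_{≠e}} h` (`e` avoided by some nest-free
perfect matching) fail to be a single monomial. [cite: HrubesYehudayoff2021, §6 Problem 2] -/
theorem nnDivisionHard_iff_arcNonGenericTier :
    Summit.ValiantsHypothesis.ValiantsHypothesis.Theses.FifoMatching.NNDivisionHard ↔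
    ∀ c : ℕ, ∃ n₀ : ℕ, ∀ n ≥ n₀, ∀ h : MvPolynomial (Fin (2 * n) × Fin (2 * n)) ℝ≥0, h ≠ 0 →
      (∀ e : Fin (2 * n) × Fin (2 * n),
        (∃ M ∈ nestFreeMatchings (2 * n), ∀ j ∈ openers M, (j, M j) ∉ ({e} : Finset (Fin (2 * n) × Fin (2 * n)))) →
        ∀ (d : (Fin (2 * n) × Fin (2 * n)) →₀ ℕ) (a : ℝ≥0), a ≠ 0 →
          topComponent (fun v : Fin (2 * n) × Fin (2 * n) =>
            if v ∈ ({e} : Finset (Fin (2 * n) × Fin (2 * n))) then 0 else 1) h ≠ monomial d a) →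
      2 ^ ((Nat.log 2 n + c) ^ c) < complexity (nestFreeMatchingPoly n ℝ≥0 * h) + complexity h := by
  constructor
  · intro hN c
    obtain ⟨n₀, hn₀⟩ := hN c
    exact ⟨n₀, fun n hn h hh _ => hn₀ n hn h hh⟩
  · intro H c
    obtain ⟨n₀, hn₀⟩ := H c
    obtain ⟨n₁, hn₁⟩ := arcGeneric_not_certificate_qp c
    refine ⟨max n₀ n₁, fun n hn h hh => ?_⟩
    by_cases hgen : ∃ e : Fin (2 * n) × Fin (2 * n),
        (∃ M ∈ nestFreeMatchings (2 * n), ∀ j ∈ openers M, (j, M j) ∉ ({e} : Finset (Fin (2 * n) × Fin (2 * n)))) ∧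
        ∃ (d : (Fin (2 * n) × Fin (2 * n)) →₀ ℕ) (a : ℝ≥0), a ≠ 0 ∧
          topComponent (fun v : Fin (2 * n) × Fin (2 * n) =>
            if v ∈ ({e} : Finset (Fin (2 * n) × Fin (2 * n))) then 0 else 1) h = monomial d a
    · obtain ⟨e, he, d, a, ha, htop⟩ := hgen
      exact hn₁ n (le_trans (le_max_right _ _) hn) e he h d a ha htop
    · push Not at hgen
      exact hn₀ n (le_trans (le_max_left _ _) hn) h hh fun e he d a ha => hgen e he d a ha

end Summit.ValiantsHypothesis.ValiantsHypothesis.Theorems.FifoMatching.NNDivisionHard.ArcGenericTier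

end
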